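import Literature.IUT.HodgeTheaters.TemperedCoveringsOfProp36
import HarnessLib

/-!
# [IUTchI] Rmk. 2.2.2 ("`Π^tp_𝔾` is normally terminal in `Π̂_𝔾`") for the CANONICAL 𝔾-data of a graph of anabelioids

Mochizuki, *Inter-universal Teichmüller theory I*, kurims manuscript (May 2020), §2, Remark 2.2.2 p. 46 and
Prop. 2.2 p. 45 [cite: Mochizuki2012, Rmk 2.2.2 p.46] (D-0012 claim key; nothing of the series is asserted
here), over [SemiAnbd] Prop. 3.6 / Thm. 3.7 [cite: MochizukiSemiAnbd2006, Thm 3.7(iii) pp.40-41].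
PROOF-ONLY companion of `TemperedCoveringsOfProp36.lean` (abc-iut L3-t7): the third member of the
[IUTchI] §2 triple Prop. 2.1 / Prop. 2.2 / Rmk. 2.2.2 for the canonical data `TemperedGraphGroupData.ofProp36`
(`Π^tp_𝔾 := π₁^temp(𝒢)`, `Π̂_𝔾 :=` its profinite completion; `TemperedGraphGroupDataOfProp36.lean`): the
`TemperedNormallyTerminal` packaging (commensurably terminal ⇒ normally terminal,
`IsCommensurablyTerminal.isNormallyTerminal`) of `tp_isCommensurablyTerminal_ofProp36_at` (`c`, `e`, `hPC`,
`hGal`, `hVI` by name).  REMAINING hypotheses, verbatim and unchanged: `hCV : CompactInVerticialAt 𝒢`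
([SemiAnbd] Thm. 3.7 (iii) at `𝒢`), a family `Λv` of verticial subgroups (`hΛv`; one exists by
`exists_verticialFamily_of_prop36`) and the node data `src/tgt/c₁/c₂` with (A3) = [NodNon] Lem. 1.9 (ii)
(`hA3`).  Typed ≠ discharged; nothing here bears on [IUTchIII] Cor. 3.12.
-/

noncomputable section

namespace Literature.IUT.HodgeTheaters

open CategoryTheory
open scoped Pointwise
open Literature.AnabelianGeometry.SemiGraphs Literature.AnabelianGeometry.SemiGraphs.ProfiniteSemiGraph
open Literature.AnabelianGeometry.AbsoluteAnabelian (IsCommensurablyTerminal)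

universe u

namespace TemperedGraphGroupData

variable (𝒢 : ProfiniteSemiGraph.{u}) (h37 : 𝒢.Thm37Hypotheses)
  (Sigma SigmaHat : Set ℕ) (hsub : Sigma ⊆ SigmaHat) (hne : Sigma.Nonempty)
  (hprime : ∀ p ∈ SigmaHat, p.Prime)
  (TpH : Subgroup (𝒢.temperedPiChart h37.toProp36Hypotheses).G)
  (HatH : Subgroup
    (exists_completion_of_prop36 𝒢 h37.toProp36Hypotheses (𝒢.temperedPiChart h37.toProp36Hypotheses)).choose)
  (hle : TpH.map
    (exists_completion_of_prop36 𝒢 h37.toProp36Hypotheses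
      (𝒢.temperedPiChart h37.toProp36Hypotheses)).choose_spec.choose.toMonoidHom ≤ HatH)

/-- **[IUTchI] Rmk. 2.2.2 for the canonical 𝔾-data `ofProp36`: `Π^tp_𝔾 = π₁^temp(𝒢)` is NORMALLY TERMINAL in
its profinite completion `Π̂_𝔾`** (the `TemperedNormallyTerminal` packaging: commensurably terminal ⇒ normally
terminal), `c`, `e`, `hPC`, `hGal`, `hVI` by name; conditional exactly on Thm. 3.7 (iii) at `𝒢` (`hCV`), a
verticial family and the node data with (A3). ([IUTchI] Rmk 2.2.2 p.46) [claim: Mochizuki2012, status: disputed] -/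
theorem temperedNormallyTerminal_ofProp36_at (hCV : CompactInVerticialAt 𝒢)
    (Λv : 𝒢.graph.Vertex →
      Subgroup (ofProp36 𝒢 h37.toProp36Hypotheses Sigma SigmaHat hsub hne hprime TpH HatH hle).Tp)
    (hΛv : ∀ v, Λv v ∈ verticialSubgroups (𝒢.temperedPiChart h37.toProp36Hypotheses) v)
    {E : Type*} (src tgt : E → 𝒢.graph.Vertex)
    (c₁ c₂ : E → (ofProp36 𝒢 h37.toProp36Hypotheses Sigma SigmaHat hsub hne hprime TpH HatH hle).Tp)
    (hA3 : letI D := ofProp36 𝒢 h37.toProp36Hypotheses Sigma SigmaHat hsub hne hprime TpH HatH hle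
      ∀ (v w : 𝒢.graph.Vertex) (g h : D.Hat),
      MulAut.conj g • (Λv v).map D.ι ⊓ MulAut.conj h • (Λv w).map D.ι ≠ ⊥ →
        (v = w ∧ g⁻¹ * h ∈ (Λv v).map D.ι) ∨
        ∃ (e : E) (k : D.Hat), ∃ p ∈ (Λv (src e)).map D.ι, ∃ q ∈ (Λv (tgt e)).map D.ι,
          (src e = v ∧ tgt e = w ∧ g = k * D.ι (c₁ e) * p ∧ h = k * D.ι (c₂ e) * q) ∨
          (src e = w ∧ tgt e = v ∧ h = k * D.ι (c₁ e) * p ∧ g = k * D.ι (c₂ e) * q)) :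
    (ofProp36 𝒢 h37.toProp36Hypotheses Sigma SigmaHat hsub hne hprime TpH HatH hle).TemperedNormallyTerminal :=
  ⟨fun _ => (tp_isCommensurablyTerminal_ofProp36_at 𝒢 h37 Sigma SigmaHat hsub hne hprime TpH HatH hle hCV Λv
    hΛv src tgt c₁ c₂ hA3).isNormallyTerminal⟩

end TemperedGraphGroupData

end Literature.IUT.HodgeTheaters

end
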